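import Summits.AtomisticToContinuum.Crystallization.Theorems.FrustratedLawDichotomySphericalLinkCert

/-!
# FrustratedLawDichotomy · crux `AperiodicFrustratedLawGap` (stmt-AtomisticToContinuum-27623) — THE ROTATION GAUGE FOR `G` ON THE SPHERE:
# `SphericalLinkCert θ ⟸ GaugedSphericalLinkCert θ` (decomp-a2c, prover hand 2, gen 11)

`SphericalLinkCert θ` (p825726) quantifies over all twelve-tuples of unit vectors; a branch-and-bound certificate needs a compact,
gauge-fixed parameter domain.  All hypotheses are inner products and the conclusion concerns the graph `B` only, so the statement is
invariant under linear isometries of `ℝ³`; this file fixes the gauge once and for all: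

* `GaugedSphericalLinkCert θ` — the same statement restricted to tuples with `e 0 = (0, 0, 1)` (north pole) and SOME `B`-neighbour `u₁`
  of `0` on the meridian `{y = 0, x ≥ 0}` (so `e u₁ = (sin φ, 0, cos φ)` with `cos φ` in the bond window): `21` free parameters;
* ★ `sphericalLinkCert_of_gauged : 0 ≤ θ → θ < 1 → GaugedSphericalLinkCert θ → SphericalLinkCert θ` — choose a neighbour `u₁` of `0`
  (4-regularity), build an orthonormal basis `(b₀, b₁, b₂)` with `b₂ = e 0` and `e u₁ ∈ span(b₀, b₂)`, `⟪b₀, e u₁⟫ ≥ 0`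
  (`Orthonormal.exists_orthonormalBasis_extension_of_card_eq`), and transport by the isometry `b.repr : ℝ³ ≃ₗᵢ ℝ³`;
* by name: `linkCert_of_gauged`, `aperiodicFrustratedLawGap_of_gaugedSphericalLinkCert`, `noFrustratedPeriodicMinimiser_of_gaugedSphericalLinkCert`.
`[folklore]`; one definition; no `sorry`; no `instance`/`notation`.
-/

noncomputable section

namespace Summit.AtomisticToContinuum.Crystallization.Theorems.FrustratedLawDichotomySphericalGauge

open Real RealInnerProductSpace
open Literature.Geometry.DiscreteGeometry
open Summit.AtomisticToContinuum.Crystallization.Theses.PricedLinkCensus (ChargedEnergyGap)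
open Summit.AtomisticToContinuum.Crystallization.Theorems.FrustratedLawDichotomyTwoShellRigidityCut
  (E3 CapForcing KR2Shape aperiodicFrustratedLawGap_of_cut noFrustratedPeriodicMinimiser_of_cut)
open Summit.AtomisticToContinuum.Crystallization.Theorems.FrustratedLawDichotomyCappedRigidityCert (CappedCert)
open Summit.AtomisticToContinuum.Crystallization.Theorems.FrustratedLawDichotomyCappedRigidityCertPatterns (cappedRigidity_of_cert)
open Summit.AtomisticToContinuum.Crystallization.Theorems.FrustratedLawDichotomyLinkCert (LinkCert linkClassification_of_linkCert)
open Summit.AtomisticToContinuum.Crystallization.Theorems.FrustratedLawDichotomySphericalLinkCert (SphericalLinkCert linkCert_of_spherical)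

/-! ### §1 The gauged statement -/

/-- **`GaugedSphericalLinkCert θ`** — `SphericalLinkCert θ` restricted to gauge-fixed tuples: `e 0` is the north pole `(0, 0, 1)` and some
`B`-neighbour `u₁` of `0` lies on the half-meridian `y = 0, x ≥ 0`. [certificate target; `(S²)¹²` modulo rotations = 21 parameters] -/
def GaugedSphericalLinkCert (θ : ℝ) : Prop :=
  ∀ (e : Fin 12 → E3) (B : SimpleGraph (Fin 12)),
    (∀ u, ‖e u‖ = 1) →
    (e 0 0 = 0 ∧ e 0 1 = 0 ∧ e 0 2 = 1) →
    (∃ u₁, B.Adj 0 u₁ ∧ e u₁ 1 = 0 ∧ 0 ≤ e u₁ 0) →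
    (∀ u v, u ≠ v → ⟪e u, e v⟫ ≤ 1 - (1 + θ)⁻¹ ^ 2 / 2) →
    (∀ u v, B.Adj u v → 1 - (1 + θ) ^ 2 / 2 ≤ ⟪e u, e v⟫) →
    (∀ u v, u ≠ v → ¬ B.Adj u v → ⟪e u, e v⟫ < (1 + θ) / 2) →
    (∀ u, ({v | B.Adj u v} : Set (Fin 12)).ncard = 4) →
      (∃ τ₀ : ↥fccKissingPattern → Fin 12, Function.Bijective τ₀ ∧
          ∀ u v : ↥fccKissingPattern, B.Adj (τ₀ u) (τ₀ v) ↔ dist (u : E3) (v : E3) = 1) ∨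
        (∃ τ₀ : ↥hcpKissingPattern → Fin 12, Function.Bijective τ₀ ∧
          ∀ u v : ↥hcpKissingPattern, B.Adj (τ₀ u) (τ₀ v) ↔ dist (u : E3) (v : E3) = 1)

/-! ### §2 An adapted orthonormal frame -/

/-- **Adapted frame**: for unit vectors `n, m` with `⟪n, m⟫ ≠ ±1` there is an orthonormal basis `b` of `ℝ³` with `b 2 = n`, `⟪b 1, m⟫ = 0`
and `0 ≤ ⟪b 0, m⟫`. [folklore] -/
theorem exists_adapted_basis {n m : E3} (hn : ‖n‖ = 1) (hm : ‖m‖ = 1) (ht : ⟪n, m⟫ ^ 2 < 1) :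
    ∃ b : OrthonormalBasis (Fin 3) ℝ E3, b 2 = n ∧ ⟪b 1, m⟫ = 0 ∧ 0 ≤ ⟪b 0, m⟫ := by
  set t : ℝ := ⟪n, m⟫ with ht_def
  set v : E3 := m - t • n with hv_def
  have hnn : ⟪n, n⟫ = 1 := by rw [real_inner_self_eq_norm_sq, hn]; norm_num
  have hmm : ⟪m, m⟫ = 1 := by rw [real_inner_self_eq_norm_sq, hm]; norm_num
  have hvn : ⟪v, n⟫ = 0 := by
    rw [hv_def, inner_sub_left, real_inner_smul_left, hnn, real_inner_comm]; ring
  have hvv : ⟪v, v⟫ = 1 - t ^ 2 := by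
    rw [hv_def, inner_sub_left, inner_sub_right, inner_sub_right, real_inner_smul_left, real_inner_smul_right,
      real_inner_smul_left, real_inner_smul_right, hmm, hnn, real_inner_comm n m]
    ring
  have hvpos : 0 < ‖v‖ := by
    have h : 0 < ‖v‖ ^ 2 := by rw [← real_inner_self_eq_norm_sq, hvv]; linarith
    exact lt_of_le_of_ne (norm_nonneg _) (fun h0 => by rw [← h0] at h; norm_num at h)
  set b₀ : E3 := ‖v‖⁻¹ • v with hb₀
  have hb₀n : ‖b₀‖ = 1 := by rw [hb₀, norm_smul, norm_inv, norm_norm, inv_mul_cancel₀ hvpos.ne']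
  have hb₀_n : ⟪b₀, n⟫ = 0 := by rw [hb₀, real_inner_smul_left, hvn, mul_zero]
  -- extend the orthonormal pair (b₀, n) on the index set {0, 2}
  let f : Fin 3 → E3 := ![b₀, 0, n]
  have hcard : Module.finrank ℝ E3 = Fintype.card (Fin 3) := by
    rw [finrank_euclideanSpace_fin, Fintype.card_fin]
  have hon : Orthonormal ℝ (({0, 2} : Set (Fin 3)).restrict f) := by
    rw [orthonormal_iff_ite]
    rintro ⟨i, hi⟩ ⟨j, hj⟩
    simp only [Set.mem_insert_iff, Set.mem_singleton_iff] at hi hj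
    rcases hi with rfl | rfl <;> rcases hj with rfl | rfl
    · simp [f, hb₀n]
    · simp [f, hb₀_n]
    · have : ⟪n, b₀⟫ = 0 := by rw [real_inner_comm]; exact hb₀_n
      simp [f, this]
    · simp [f, hn]
  obtain ⟨b, hb⟩ := Orthonormal.exists_orthonormalBasis_extension_of_card_eq hcard hon
  have hb0 : b 0 = b₀ := by simpa [f] using hb 0 (by simp)
  have hb2 : b 2 = n := by simpa [f] using hb 2 (by simp)
  refine ⟨b, hb2, ?_, ?_⟩
  · -- m = v + t n = ‖v‖ b 0 + t b 2, and b 1 ⟂ b 0, b 2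
    have hm_eq : m = ‖v‖ • b 0 + t • b 2 := by
      rw [hb0, hb2, hb₀, smul_smul, mul_inv_cancel₀ hvpos.ne', one_smul, hv_def]; abel
    have h10 : ⟪b 1, b 0⟫ = 0 := b.orthonormal.inner_eq_zero (by decide)
    have h12 : ⟪b 1, b 2⟫ = 0 := b.orthonormal.inner_eq_zero (by decide)
    rw [hm_eq, inner_add_right, real_inner_smul_right, real_inner_smul_right, h10, h12]; ring
  · have hm_eq : m = v + t • n := by rw [hv_def]; abel
    rw [hb0, hm_eq, inner_add_right, real_inner_smul_right, hb₀_n, mul_zero, add_zero, hb₀, real_inner_smul_left,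
      real_inner_self_eq_norm_sq]
    positivity

/-! ### §3 The reduction -/

/-- ★ **THE GAUGE REDUCTION `GaugedSphericalLinkCert θ → SphericalLinkCert θ`** (`0 ≤ θ < 1`): pick a `B`-neighbour `u₁` of `0`, rotate
`e 0` to the pole and `e u₁` to the half-meridian by an adapted orthonormal frame; inner products, hence all hypotheses, are preserved,
and the conclusion is about `B` only. [folklore] -/
theorem sphericalLinkCert_of_gauged {θ : ℝ} (hθ : 0 ≤ θ) (hθ1 : θ < 1) (hG : GaugedSphericalLinkCert θ) : SphericalLinkCert θ := by
  intro e B hunit hall hbond hnon hreg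
  -- a neighbour of 0
  have hne : ({v | B.Adj 0 v} : Set (Fin 12)).Nonempty := by
    apply Set.nonempty_of_ncard_ne_zero
    rw [hreg 0]; norm_num
  obtain ⟨u₁, hu₁⟩ := hne
  have hu₁' : B.Adj 0 u₁ := hu₁
  -- the angle between e 0 and e u₁ is neither 0 nor π
  have ht : ⟪e 0, e u₁⟫ ^ 2 < 1 := by
    have h1 : ⟪e 0, e u₁⟫ ≤ 1 - (1 + θ)⁻¹ ^ 2 / 2 := hall 0 u₁ hu₁'.ne
    have h2 : 1 - (1 + θ) ^ 2 / 2 ≤ ⟪e 0, e u₁⟫ := hbond 0 u₁ hu₁'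
    have h3 : 0 < (1 + θ)⁻¹ ^ 2 := by positivity
    have h4 : (1 + θ) ^ 2 < 4 := by nlinarith
    have hlo : -1 < ⟪e 0, e u₁⟫ := by linarith
    have hhi : ⟪e 0, e u₁⟫ < 1 := by linarith
    nlinarith
  obtain ⟨b, hb2, hb1m, hb0m⟩ := exists_adapted_basis (hunit 0) (hunit u₁) ht
  -- transport
  set e' : Fin 12 → E3 := fun u => b.repr (e u) with he'
  have hinner : ∀ u w, ⟪e' u, e' w⟫ = ⟪e u, e w⟫ := fun u w => b.repr.inner_map_map (e u) (e w)
  have hnorm : ∀ u, ‖e' u‖ = 1 := fun u => by rw [he', LinearIsometryEquiv.norm_map]; exact hunit u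
  have hcoord : ∀ u (i : Fin 3), e' u i = ⟪b i, e u⟫ := fun u i => b.repr_apply_apply (e u) i
  have hnn : ⟪e 0, e 0⟫ = 1 := by rw [real_inner_self_eq_norm_sq, hunit 0]; norm_num
  refine hG e' B hnorm ⟨?_, ?_, ?_⟩ ⟨u₁, hu₁', ?_, ?_⟩ (fun u v huv => (hinner u v).symm ▸ hall u v huv)
    (fun u v huv => (hinner u v).symm ▸ hbond u v huv) (fun u v huv hn => (hinner u v).symm ▸ hnon u v huv hn) hreg
  · rw [hcoord, ← hb2]; exact b.orthonormal.inner_eq_zero (by decide)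
  · rw [hcoord, ← hb2]; exact b.orthonormal.inner_eq_zero (by decide)
  · rw [hcoord, hb2, hnn]
  · rw [hcoord]; exact hb1m
  · rw [hcoord]; exact hb0m

/-- **`LinkCert θ` from the gauged spherical certificate** (`0 ≤ θ ≤ 1/2`). [folklore] -/
theorem linkCert_of_gauged {θ : ℝ} (hθ : 0 ≤ θ) (hθ1 : θ ≤ 1 / 2) (hG : GaugedSphericalLinkCert θ) : LinkCert θ :=
  linkCert_of_spherical hθ hθ1 (sphericalLinkCert_of_gauged hθ (by linarith) hG)

/-- **`AperiodicFrustratedLawGap` (crux of item 27623) BY NAME** from `MuEquilibriumDoor ∧ ChargedEnergyGap ∧ GaugedSphericalLinkCert(1/100)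
∧ CapForcing(1/100) ∧ CappedCert fcc ∧ CappedCert hcp`. [folklore] -/
theorem aperiodicFrustratedLawGap_of_gaugedSphericalLinkCert
    (hDoor : Summit.AtomisticToContinuum.Crystallization.Theses.GrainCoreNetworkSplit.MuEquilibriumDoor) (hgap : ChargedEnergyGap)
    (hG : GaugedSphericalLinkCert (1 / 100)) (hP : CapForcing (1 / 100))
    (hf : CappedCert (1 / 100) (1 / 20) fccKissingPattern) (hh : CappedCert (1 / 100) (1 / 20) hcpKissingPattern) :
    Summit.AtomisticToContinuum.Crystallization.Theses.FrustratedLawDichotomy.AperiodicFrustratedLawGap :=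
  aperiodicFrustratedLawGap_of_cut hDoor hgap (linkClassification_of_linkCert (linkCert_of_gauged (by norm_num) (by norm_num) hG)) hP
    (cappedRigidity_of_cert hf hh)

/-- **Item 26654 `NoFrustratedPeriodicMinimiser`, door-free**, from `ChargedEnergyGap ∧ GaugedSphericalLinkCert(1/100) ∧ CapForcing(1/100)
∧ CappedCert ×2`. [folklore] -/
theorem noFrustratedPeriodicMinimiser_of_gaugedSphericalLinkCert (hgap : ChargedEnergyGap)
    (hG : GaugedSphericalLinkCert (1 / 100)) (hP : CapForcing (1 / 100))
    (hf : CappedCert (1 / 100) (1 / 20) fccKissingPattern) (hh : CappedCert (1 / 100) (1 / 20) hcpKissingPattern) :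
    Summit.AtomisticToContinuum.Crystallization.Theses.PeriodicChargeSplit.NoFrustratedPeriodicMinimiser :=
  noFrustratedPeriodicMinimiser_of_cut hgap (linkClassification_of_linkCert (linkCert_of_gauged (by norm_num) (by norm_num) hG)) hP
    (cappedRigidity_of_cert hf hh)

end Summit.AtomisticToContinuum.Crystallization.Theorems.FrustratedLawDichotomySphericalGauge

end
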